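import Literature.NumberTheory.Transcendental.SemistabilityInduction
import Literature.NumberTheory.Transcendental.UnivExtAlgPointsDivision
import HarnessLib

/-!
# The Semistability Theorem for `M_κ` at ALL algebraic points, from the Baker engine

Topic: `Literature/NumberTheory/Transcendental`. A proofs-only file (theorems only, no definitions,
no named facts) of the unit `provefact-Literature.NumberTheory.Transcendental.s-efcbe22610` (fact
`Literature.NumberTheory.Transcendental.semistabilityTheorem_std`, Baker–Wüstholz's Semistability
Theorem, *Logarithmic Forms and Diophantine Geometry*, Thm. 6.15, for the explicit group varieties
`M_κ = 𝔾ₘ^β × P_κ`, every proper semistable `ℚ̄`-rational `𝔟`, at EVERY algebraic point).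

The tree proves this statement at the points with TORSION abelian part
(`SemistabilityInduction.semistabilityTheorem_std_tors_of_philippon`, modulo Philippon's zero
estimate `philippon1986_std`), by two runs of Baker's method (`NumCondFamily.dichotomy'`,
`TorsionDichotomy.torsionDichotomy`) closed over a stable `𝔟` (`StableClosing.mem_ker_of_stable`)
and an induction over borderline quotients and subgroups. This file isolates exactly what the
general statement still needs from the analytic ("constructive") half of op. cit. §6.8 and proves
everything else:

* `Std.dichotomy_of_engine` — the closing logic of `ClosingDichotomy.dichotomy` (Philippon's zero
  estimate, the index descent `Semistable.index_le`, the orbit count) run from an ENGINE OUTPUT at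
  the point `w`: a form `P` of degree `D ≥ 1` with `F_P ≢ 0` vanishing to order `≥ nT + 1` along `𝔟`
  at `s·w`, `0 ≤ s ≤ nS`, whose parameters beat Philippon's constant
  (`c·D^n < binom(T+e, e)·(S+1)·D^m`, and `< binom(T+e, e)·D^m` off the borderline) — op. cit.
  pp. 117–119, steps "construction of `P`" to "`(6.2)` holds with `γ` in place of `γ'`", which for
  torsion abelian part is `BakerData.engine₂` + `BakerData.admissibleParams_of_lt`
  (`engine_of_algTors` below records that the landed torsion engine delivers this output);
* `Std.mem_ker_of_stable_alg` — **the second run needs no generalisation**: if the obstruction of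
  the first run has `Lie K = 0` then `r·w ∈ ker(exp)`, so `w` HAS torsion abelian part
  (`mem_AlgTors_of_smul_mem_ker`) and the landed `torsionDichotomy` applies verbatim;
* the induction layer at general algebraic points: `Std.inv_natCast_smul_mem_Alg` (division points
  of algebraic points are algebraic, from `PeriodPair.IsUnivExtAlgPoint.div_nat`),
  `Std.QuotData.Φ_mem_Alg`, `Std.SubData.mem_Alg_of_ι` (the `Alg` halves of the landed `AlgTors`
  transport lemmas), `Std.mem_ker_of_semistable_card_alg` (strong induction on `dim M_κ`, as in
  `SemistabilityInduction.mem_ker_of_semistable_card`);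
* `semistabilityTheorem_std_of_engine` — **`semistabilityTheorem_std` follows from
  `philippon1986_std` and the engine output at all algebraic points of all `M_κ`.**

What remains for `semistabilityTheorem_std_holds` is therefore (i) the named fact
`philippon1986_std` and (ii) the engine output at algebraic points with NON-torsion abelian part,
i.e. `BakerField.BakerData` without `TorsionCoords`: the number field, denominators and conjugates
of the generator values at `s·v` for non-torsion `E`-coordinates, of height `≪ s²` instead of
`≪ s` (op. cit. p. 116, "`h(ℓg) ≤ c₃ℓ²h(g) + c₄`"; tree: `EllipticCurves/HeightsMultiples.lean`,
`EllipticCurves/WeierstrassPMultiplication.lean`, `UnivExtAlgPointsDivision.lean`), fed through the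
Siegel and Liouville steps with the parameter choice of op. cit. p. 119 (`DS² ≪ T`). The engine
hypothesis is stated inline (D-0026: no new named fact); it is an existence statement about
auxiliary forms, not a restatement of the theorem. The same two inputs give the hyperplane form at
all algebraic points used for `analyticSubgroupTheorem_GaGmE` (`AnalyticSubgroupHyperplane.lean`,
`semistabilityTheorem_std.hyperplane`).

## References

* A. Baker, G. Wüstholz, *Logarithmic Forms and Diophantine Geometry*, New Math. Monogr. 9, CUP
  2007: Thm. 6.15, §6.8 (p. 115: induction over `G^*` and `B ∩ ker π`; pp. 116–119: proof of
  Thm. 6.15; p. 117: division points; p. 119: "`(6.2)` holds with `γ` in place of `γ'`" and the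
  appeal to the multiplicity estimate). [BakerWustholz2007]
* P. Philippon, *Lemmes de zéros dans les groupes algébriques commutatifs*, Bull. Soc. Math.
  France 114 (1986), Thm. 2.1. [Philippon1986]
-/

noncomputable section

open Module Submodule Complex
open scoped PeriodPair

namespace Literature.NumberTheory.Transcendental

namespace GaGmE

namespace Std

open LiePresentation

variable {β γ δ : Type} [Fintype β] [Fintype γ] [Fintype δ]

/-! ### Algebraic points: division, torsion, transport -/

section Points

variable (L : PeriodPair) (κM : δ → γ → Kbar)

omit [Fintype β] [Fintype δ] in
/-- **`Std.Alg` is stable under division**: if `exp(w)` is algebraic then so is `exp(w/m)`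
(`m ≥ 1`) — roots of algebraic numbers are algebraic, and the division points of `ℚ̄`-points of
`E♮` are `ℚ̄`-points (`PeriodPair.IsUnivExtAlgPoint.div_nat`).
[cite: BakerWustholz2007, §6.8 (p. 117: "The coordinates of γ are contained in an extension 𝕂_ℓ of 𝕂")] -/
theorem inv_natCast_smul_mem_Alg (h₂ : IsAlgebraic ℚ L.g₂) (h₃ : IsAlgebraic ℚ L.g₃)
    {w : β ⊕ (γ ⊕ δ) → ℂ} (hw : w ∈ Alg L κM) {m : ℕ} (hm : 0 < m) :
    ((m : ℂ)⁻¹ • w) ∈ Alg L κM := by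
  obtain ⟨hy, t', hzt, hs⟩ := hw
  have hminv : IsAlgebraic ℚ ((m : ℂ)⁻¹) := (isAlgebraic_nat m).inv
  refine ⟨fun j => ?_, fun b => (m : ℂ)⁻¹ * t' b, fun b => ?_, fun e => ?_⟩
  · refine IsAlgebraic.of_pow hm ?_
    have e : cexp (((m : ℂ)⁻¹ • w) (iy j)) ^ m = cexp (w (iy j)) := by
      rw [← Complex.exp_nat_mul]
      simp only [Pi.smul_apply, smul_eq_mul]
      congr 1
      field_simp [(show (m : ℂ) ≠ 0 by exact_mod_cast hm.ne')]
    rw [e]; exact hy j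
  · have h := (hzt b).div_nat h₂ h₃ (n := m) hm.ne'
    simp only [Pi.smul_apply, smul_eq_mul]
    rw [div_eq_inv_mul, div_eq_inv_mul] at h
    exact h
  · have e1 : ((m : ℂ)⁻¹ • w) (is e) - ∑ b, (κM e b : ℂ) * ((m : ℂ)⁻¹ * t' b) =
        (m : ℂ)⁻¹ * (w (is e) - ∑ b, (κM e b : ℂ) * t' b) := by
      simp only [Pi.smul_apply, smul_eq_mul, Finset.mul_sum, mul_sub]
      congr 1
      exact Finset.sum_congr rfl fun b _ => by ring
    rw [e1]; exact hminv.mul (hs e)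

omit [Fintype β] [Fintype δ] in
/-- **An algebraic point with a multiple in `ker(exp)` has torsion abelian part**: if
`exp(w)` is algebraic and `r·w ∈ ker(exp_{M_κ})` for some `r ≥ 1`, then `w ∈ Std.AlgTors`.
[folklore] -/
theorem mem_AlgTors_of_smul_mem_ker {w : β ⊕ (γ ⊕ δ) → ℂ} (hw : w ∈ Alg L κM) {r : ℕ} (hr : 0 < r)
    (hrw : ((r : ℂ) • w) ∈ ker L κM) : w ∈ AlgTors L κM := by
  obtain ⟨-, m, n, hz, -⟩ := hrw
  refine ⟨hw, fun b => ⟨r, hr, ?_⟩⟩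
  have e : (r : ℂ) * w (iz b) = m b * L.ω₁ + n b * L.ω₂ := by
    have := hz b
    simpa only [Pi.smul_apply, smul_eq_mul] using this
  rw [e]
  exact PeriodPair.mem_lattice.mpr ⟨m b, n b, rfl⟩

end Points

namespace QuotData

variable {κM : δ → γ → Kbar} {D₀ : SubgroupData β γ δ κM} (Q : QuotData D₀)

/-- **`Φ : Lie M_κ → Lie(M_κ/K₀)` maps `Alg(M_κ)` into `Alg(M_κ/K₀)`** (the `Alg` half of the
landed `QuotData.Φ_mem_AlgTors`). [folklore] -/
theorem Φ_mem_Alg {L : PeriodPair} (h₂ : IsAlgebraic ℚ L.g₂) (h₃ : IsAlgebraic ℚ L.g₃)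
    {w : β ⊕ (γ ⊕ δ) → ℂ} (hw : w ∈ Alg L κM) : Q.Φ w ∈ Alg L Q.κM' := by
  obtain ⟨hy, t, hzt, hs⟩ := hw
  refine ⟨fun j => ?_, fun b => ∑ k, (Q.cv b k : ℂ) * t k, fun b => ?_, fun e => ?_⟩
  · rw [Φ_iy, Complex.exp_sum]
    refine Finset.prod_induction _ (fun x => IsAlgebraic ℚ x) (fun a b ha hb => ha.mul hb)
      isAlgebraic_one fun i _ => ?_
    rw [Complex.exp_int_mul]
    exact isAlgebraic_zpow (hy i) _
  · rw [Φ_iz]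
    exact PeriodPair.IsUnivExtAlgPoint.sum_int_mul h₂ h₃ _ _ _ _ fun k _ => hzt k
  · rw [Φ_is]
    have hκ : ∀ k, (∑ e', (Q.ξv e e' : ℂ) * (κM e' k : ℂ)) = ∑ b, (Q.κM' e b : ℂ) * (Q.cv b k : ℂ) := by
      intro k
      have := congrArg (algebraMap Kbar ℂ) (Q.κM'_spec e k)
      simpa [map_sum, map_mul] using this
    have e1 : ∑ e', (Q.ξv e e' : ℂ) * w (is e') - ∑ b, (Q.κM' e b : ℂ) * ∑ k, (Q.cv b k : ℂ) * t k =
        ∑ e', (Q.ξv e e' : ℂ) * (w (is e') - ∑ k, (κM e' k : ℂ) * t k) := by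
      have e2 : ∑ b, (Q.κM' e b : ℂ) * ∑ k, (Q.cv b k : ℂ) * t k =
          ∑ k, (∑ b, (Q.κM' e b : ℂ) * (Q.cv b k : ℂ)) * t k := by
        simp only [Finset.mul_sum, Finset.sum_mul]
        rw [Finset.sum_comm]
        exact Finset.sum_congr rfl fun k _ => Finset.sum_congr rfl fun b _ => by ring
      have e3 : ∑ e', (Q.ξv e e' : ℂ) * (w (is e') - ∑ k, (κM e' k : ℂ) * t k) =
          ∑ e', (Q.ξv e e' : ℂ) * w (is e') - ∑ k, (∑ e', (Q.ξv e e' : ℂ) * (κM e' k : ℂ)) * t k := by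
        simp only [mul_sub, Finset.sum_sub_distrib, Finset.mul_sum, Finset.sum_mul]
        congr 1
        rw [Finset.sum_comm]
        exact Finset.sum_congr rfl fun k _ => Finset.sum_congr rfl fun e' _ => by ring
      rw [e2, e3]
      simp only [hκ]
    rw [e1]
    refine Finset.sum_induction _ (fun x => IsAlgebraic ℚ x) (fun a b ha hb => ha.add hb)
      isAlgebraic_zero fun e' _ => ?_
    exact (isAlgebraic_coe_Kbar (Q.ξv e e')).mul (hs e')

end QuotData

namespace SubData

variable {κM : δ → γ → Kbar} {D₀ : SubgroupData β γ δ κM} (S : SubData D₀)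

/-- **Algebraic points of `K₀` come from algebraic points of `M_κ' ≅ K₀`** (the `Alg` half of the
landed `SubData.mem_AlgTors_of_ι`): if `ι w ∈ Alg(M_κ)` then `w ∈ Alg(M_κ')`. [folklore] -/
theorem mem_Alg_of_ι {L : PeriodPair} (h₂ : IsAlgebraic ℚ L.g₂) (h₃ : IsAlgebraic ℚ L.g₃)
    {w : S.σ' → ℂ} (hw : S.ι w ∈ Alg L κM) : w ∈ Alg L S.κS := by
  obtain ⟨hy, t, hzt, hs⟩ := hw
  -- the blocks of `w` through the integer left inverses
  have hwy : ∀ j', w (iy j') = ∑ i, (S.pA j' i : ℂ) * S.ι w (iy i) := fun j' => (S.pA_ι w j').symm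
  have hwz : ∀ b', w (iz b') = ∑ k, (S.pC b' k : ℂ) * S.ι w (iz k) := fun b' => (S.pC_ι w b').symm
  -- the new fibre representatives `t''_{b'} = ∑_k pC_{b'k} t_k` and `t̂ = m t''`
  set t'' : Fin S.nC → ℂ := fun b' => ∑ k, (S.pC b' k : ℂ) * t k with ht''
  set that : γ → ℂ := fun k => ∑ b', (S.mv b' k : ℂ) * t'' b' with hthat
  -- `z = m z''` and `(z, t̂)` is a `ℚ̄`-point, so `t - t̂` is algebraic
  have hz'' : ∀ b', L.IsUnivExtAlgPoint (w (iz b')) (t'' b') := by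
    intro b'
    rw [hwz b', ht'']
    exact PeriodPair.IsUnivExtAlgPoint.sum_int_mul h₂ h₃ _ _ _ _ fun k _ => hzt k
  have hzhat : ∀ k, L.IsUnivExtAlgPoint (S.ι w (iz k)) (that k) := by
    intro k
    rw [ι_iz, hthat]
    exact PeriodPair.IsUnivExtAlgPoint.sum_int_mul h₂ h₃ _ _ _ _ fun b' _ => hz'' b'
  have hu : ∀ k, IsAlgebraic ℚ (t k - that k) := by
    intro k
    have hsub := (hzt k).sub h₂ h₃ (hzhat k)
    rw [sub_self] at hsub
    exact hsub.isAlgebraic_of_zero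
  refine ⟨fun j' => ?_, t'', hz'', fun e' => ?_⟩
  · -- torus: `e^{w_y j'} = ∏ (e^{y_i})^{pA}`
    rw [hwy j', Complex.exp_sum]
    refine Finset.prod_induction _ (fun x => IsAlgebraic ℚ x) (fun a b ha hb => ha.mul hb)
      isAlgebraic_one fun i _ => ?_
    rw [Complex.exp_int_mul]
    exact isAlgebraic_zpow (hy i) _
  · -- fibre: the vector `W_e = w_s e - ∑ κ' t''` has `σ W` algebraic, hence is algebraic
    set W : Fin S.nΞ → ℂ := fun e => w (is e) - ∑ b', (S.κS e b' : ℂ) * t'' b' with hW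
    show IsAlgebraic ℚ (W e')
    have hκ : ∀ b' x, (∑ k, (κM x k : ℂ) * (S.mv b' k : ℂ)) = ∑ e, (S.κS e b' : ℂ) * (S.sv e x : ℂ) := by
      intro b' x
      have := congrArg (algebraMap Kbar ℂ) (S.κS_spec b' x)
      simpa [map_sum, map_mul] using this
    -- `∑_k κ_{xk} t̂_k = ∑_e σ_e(x) ∑_b' κ'_{eb'} t''_b'`
    have hthat' : ∀ x, ∑ k, (κM x k : ℂ) * that k = ∑ e, (S.sv e x : ℂ) * ∑ b', (S.κS e b' : ℂ) * t'' b' := by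
      intro x
      calc ∑ k, (κM x k : ℂ) * that k = ∑ b', (∑ k, (κM x k : ℂ) * (S.mv b' k : ℂ)) * t'' b' := by
            simp only [hthat, Finset.mul_sum, Finset.sum_mul]
            rw [Finset.sum_comm]
            exact Finset.sum_congr rfl fun b' _ => Finset.sum_congr rfl fun k _ => by ring
        _ = ∑ b', (∑ e, (S.κS e b' : ℂ) * (S.sv e x : ℂ)) * t'' b' := by simp only [hκ]
        _ = ∑ e, (S.sv e x : ℂ) * ∑ b', (S.κS e b' : ℂ) * t'' b' := by
            simp only [Finset.mul_sum, Finset.sum_mul]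
            rw [Finset.sum_comm]
            exact Finset.sum_congr rfl fun e _ => Finset.sum_congr rfl fun b' _ => by ring
    -- `(σ W)_x = (ι w)_s(x) - ∑ κ t + ∑ κ (t - t̂)` is algebraic
    have hV : ∀ x, ∑ e, (S.sv e x : ℂ) * W e =
        (S.ι w (is x) - ∑ k, (κM x k : ℂ) * t k) + ∑ k, (κM x k : ℂ) * (t k - that k) := by
      intro x
      have e1 : ∑ e, (S.sv e x : ℂ) * W e = S.ι w (is x) - ∑ k, (κM x k : ℂ) * that k := by
        rw [hthat' x, ι_is, ← Finset.sum_sub_distrib]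
        exact Finset.sum_congr rfl fun e _ => by rw [hW]; ring
      rw [e1]
      simp only [mul_sub, Finset.sum_sub_distrib]
      ring
    have hValg : ∀ x, IsAlgebraic ℚ (∑ e, (S.sv e x : ℂ) * W e) := by
      intro x
      rw [hV x]
      refine (hs x).add ?_
      refine Finset.sum_induction _ (fun y => IsAlgebraic ℚ y) (fun a b ha hb => ha.add hb)
        isAlgebraic_zero fun k _ => (isAlgebraic_coe_Kbar (κM x k)).mul (hu k)
    -- `σ W` has algebraic coordinates: it is a `ℚ̄`-point of `span(σ)`
    let VK : δ → Kbar := fun x => ⟨∑ e, (S.sv e x : ℂ) * W e, mem_algebraicClosure_iff.mpr (hValg x)⟩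
    have hVKx : ∀ x, ((VK x : Kbar) : ℂ) = ∑ e, (S.sv e x : ℂ) * W e := fun x => rfl
    have hVKmem : VK ∈ kPoints Kbar (span ℂ (ofK Kbar (L := ℂ) '' Set.range S.sv)) := by
      rw [mem_kPoints]
      have hofK : ofK Kbar (L := ℂ) VK = ∑ e, W e • ofK Kbar (L := ℂ) (S.sv e) := by
        funext x
        rw [ofK_apply, show algebraMap Kbar ℂ (VK x) = ((VK x : Kbar) : ℂ) from rfl, hVKx x]
        simp only [Finset.sum_apply, Pi.smul_apply, smul_eq_mul, ofK_apply]
        exact Finset.sum_congr rfl fun e _ => by rw [mul_comm]; rfl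
      rw [hofK]
      exact Submodule.sum_mem _ fun e _ => Submodule.smul_mem _ _ (subset_span ⟨S.sv e, ⟨e, rfl⟩, rfl⟩)
    rw [kPoints_span_ofK, Submodule.mem_span_range_iff_exists_fun] at hVKmem
    obtain ⟨c, hc⟩ := hVKmem
    -- compare coefficients: `W = c`
    have hWc : (fun e => W e - (c e : ℂ)) = 0 := by
      refine S.eq_zero_of_sv_sum fun x => ?_
      have h2 : ∑ e, (S.sv e x : ℂ) * (c e : ℂ) = ∑ e, (S.sv e x : ℂ) * W e := by
        rw [← hVKx x, show ((VK x : Kbar) : ℂ) = algebraMap Kbar ℂ (VK x) from rfl, ← congr_fun hc x]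
        simp only [Finset.sum_apply, Pi.smul_apply, smul_eq_mul, map_sum, map_mul]
        exact Finset.sum_congr rfl fun e _ => by rw [mul_comm]; rfl
      simp only [mul_sub, Finset.sum_sub_distrib, h2, sub_self]
    have := congr_fun hWc e'
    simp only [Pi.zero_apply, sub_eq_zero] at this
    rw [this]
    exact isAlgebraic_coe_Kbar (c e')

end SubData

/-! ### The dichotomy from an engine output -/

/-- **The dichotomy of Baker's method on `M_κ` from an engine output.** Let `Λ` have algebraic
invariants and no CM, `𝔟 ⊊ Lie M_κ` `ℚ̄`-rational and semistable, `w ∈ 𝔟`. Suppose that (when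
`𝔟 ≠ 0`) for every `c > 0` there are `D, S ≥ 1`, `T` and a form `P` of degree `D` with
`F_P ≢ 0` on `M_κ`, vanishing to order `≥ nT + 1` along `𝔟` at `s·w` for `0 ≤ s ≤ nS`, such that
for all `m < n` and `e` with `dim 𝔟·(n - m) ≤ e·n`: `c·D^n < binom(T+e, e)·(S+1)·D^m`, and
`c·D^n < binom(T+e, e)·D^m` when the index inequality is strict. Then, granted Philippon's zero
estimate, there is a connected algebraic subgroup datum `K ≠ M_κ` over `ℂ`, BORDERLINE for the
semistability of `𝔟`, with a multiple `r·w` (`r ≥ 1`) in `Lie K_ℂ + ker(exp)` — the closing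
logic of `ClosingDichotomy.dichotomy` (Philippon's obstruction, index descent, orbit count).
[cite: BakerWustholz2007, §6.8 (p. 119: "(6.2) holds with γ in place of γ'… We now appeal to Theorem 6.14")] [cite: Philippon1986, Thm 2.1] -/
theorem dichotomy_of_engine [DecidableEq γ] (hphil : philippon1986_std) (L : PeriodPair)
    (h₂ : IsAlgebraic ℚ L.g₂) (h₃ : IsAlgebraic ℚ L.g₃) (hCM : ¬ L.HasCM) (κM : δ → γ → Kbar)
    {𝔟 : Submodule ℂ (β ⊕ (γ ⊕ δ) → ℂ)} (hrat : IsKRational Kbar 𝔟) (h𝔟 : 𝔟 ≠ ⊤)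
    (hss : Semistable κM 𝔟) {w : β ⊕ (γ ⊕ δ) → ℂ} (hw𝔟 : w ∈ 𝔟)
    (heng : 0 < Module.finrank ℂ 𝔟 → ∀ c : ℝ, 0 < c →
      ∃ (D S T : ℕ) (P : MvPolynomial (Option β × ThetaIdx γ δ) ℂ), 1 ≤ D ∧ 1 ≤ S ∧
        P.IsHomogeneous D ∧ (∃ w', thetaEval L κM P w' ≠ 0) ∧
        (∀ s : ℕ, s ≤ Fintype.card (β ⊕ (γ ⊕ δ)) * S →
          VanishesAlong 𝔟 (thetaEval L κM P) ((s : ℂ) • w) (Fintype.card (β ⊕ (γ ⊕ δ)) * T + 1)) ∧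
        ∀ e m : ℕ, m < Fintype.card (β ⊕ (γ ⊕ δ)) →
          Module.finrank ℂ 𝔟 * (Fintype.card (β ⊕ (γ ⊕ δ)) - m) ≤ e * Fintype.card (β ⊕ (γ ⊕ δ)) →
          c * (D : ℝ) ^ Fintype.card (β ⊕ (γ ⊕ δ)) < (Nat.choose (T + e) e : ℝ) * ((S : ℝ) + 1) * (D : ℝ) ^ m ∧
          (Module.finrank ℂ 𝔟 * (Fintype.card (β ⊕ (γ ⊕ δ)) - m) < e * Fintype.card (β ⊕ (γ ⊕ δ)) →
            c * (D : ℝ) ^ Fintype.card (β ⊕ (γ ⊕ δ)) < (Nat.choose (T + e) e : ℝ) * (D : ℝ) ^ m)) :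
    ∃ K : SubgroupDataC β γ δ κM, K.tangent ≠ ⊤ ∧
      Module.finrank ℂ 𝔟 * (Fintype.card (β ⊕ (γ ⊕ δ)) - Module.finrank ℂ K.tangent) =
        (Module.finrank ℂ 𝔟 - Module.finrank ℂ ↥(𝔟 ⊓ K.tangent)) * Fintype.card (β ⊕ (γ ⊕ δ)) ∧
      ∃ r : ℕ, 0 < r ∧ (r : ℂ) • w ∈ preimageSubgroup L κM K := by
  classical
  set n := Fintype.card (β ⊕ (γ ⊕ δ)) with hn
  -- `dim 𝔟 < n`
  have h𝔟lt : Module.finrank ℂ 𝔟 < n := by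
    have := Submodule.finrank_lt h𝔟; simpa [hn] using this
  -- the degenerate case `𝔟 = 0`: `w = 0`, take `K = 0`
  by_cases h0 : Module.finrank ℂ 𝔟 = 0
  · have h𝔟0 : 𝔟 = ⊥ := Submodule.finrank_eq_zero.mp h0
    have hw0 : w = 0 := by rw [h𝔟0, Submodule.mem_bot] at hw𝔟; exact hw𝔟
    refine ⟨SubgroupDataC.zero κM, ?_, ?_, 1, one_pos, ?_⟩
    · rw [SubgroupDataC.tangent_zero]
      intro h
      have : Module.finrank ℂ (⊥ : Submodule ℂ (β ⊕ (γ ⊕ δ) → ℂ)) =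
          Module.finrank ℂ (⊤ : Submodule ℂ (β ⊕ (γ ⊕ δ) → ℂ)) := by rw [h]
      rw [finrank_bot, finrank_top, Module.finrank_fintype_fun_eq_card, ← hn] at this
      omega
    · rw [h0]; simp
    · rw [hw0, smul_zero]; exact AddSubgroup.zero_mem _
  have h𝔟pos : 0 < Module.finrank ℂ 𝔟 := Nat.pos_of_ne_zero h0
  -- Philippon's constant and the engine output beating it
  obtain ⟨c, hc, hZ⟩ := hphil L h₂ h₃ hCM β γ δ κM
  obtain ⟨D, S, T, P, hD1, hS, hP, hne, hvan, hineq⟩ := heng h𝔟pos c hc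
  -- Philippon's zero estimate
  obtain ⟨K, ⟨w₀, hw₀⟩, hK⟩ := hZ 𝔟 w P D S T h𝔟pos hD1 hS hP hne hvan
  -- `K ≠ M_κ`
  have hKtop : K.tangent ≠ ⊤ := by
    intro htop
    obtain ⟨w', hw'⟩ := hne
    apply hw'
    have := hw₀ (w' - w₀) (by rw [htop]; trivial)
    simpa using this
  have hm : Module.finrank ℂ K.tangent < n := by
    have := Submodule.finrank_lt hKtop; simpa [hn] using this
  -- the index inequality
  have hidx := hss.index_le κM hrat K hKtop
  set e := Module.finrank ℂ 𝔟 - Module.finrank ℂ ↥(𝔟 ⊓ K.tangent) with he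
  set m := Module.finrank ℂ K.tangent with hm'
  obtain ⟨hfull, hstrict⟩ := hineq e m hm hidx
  -- orbit dichotomy
  have horb_le := orbitCard_le L κM K w S
  have hD0 : (0 : ℝ) < (D : ℝ) := by exact_mod_cast hD1
  by_cases horb : orbitCard L κM K w S = S + 1
  · -- full orbit: numerics contradict Philippon
    exfalso
    rw [horb] at hK
    push_cast at hK hfull
    linarith
  · -- small orbit: a multiple of `w` meets `Lie K + ker`; then `K` must be borderline
    obtain ⟨r, hr, -, hrmem⟩ := orbitCard_lt_imp L κM K w S (lt_of_le_of_ne horb_le horb)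
    refine ⟨K, hKtop, ?_, r, hr, hrmem⟩
    by_contra hneq
    have hlt : Module.finrank ℂ 𝔟 * (n - m) < e * n := lt_of_le_of_ne hidx hneq
    have h1 := hstrict hlt
    have horb1 : (1 : ℝ) ≤ orbitCard L κM K w S := by exact_mod_cast one_le_orbitCard L κM K w S
    have h2 : (Nat.choose (T + e) e : ℝ) * (D : ℝ) ^ m ≤
        (Nat.choose (T + e) e : ℝ) * (orbitCard L κM K w S : ℝ) * (D : ℝ) ^ m := by
      have hch : (0 : ℝ) ≤ (Nat.choose (T + e) e : ℝ) := Nat.cast_nonneg _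
      have hpow : (0 : ℝ) ≤ (D : ℝ) ^ m := by positivity
      rw [show (Nat.choose (T + e) e : ℝ) * (D : ℝ) ^ m =
        (Nat.choose (T + e) e : ℝ) * 1 * (D : ℝ) ^ m from by ring]
      exact mul_le_mul_of_nonneg_right (mul_le_mul_of_nonneg_left horb1 hch) hpow
    linarith

/-! ### The stable case at all algebraic points -/

/-- **The Semistability Theorem for a STABLE `𝔟` at ALL algebraic points** (modulo Philippon's
zero estimate and the engine output at the point). Let `Λ` have algebraic invariants and no CM,
`𝔟 ⊊ Lie M_κ` `ℚ̄`-rational and semistable with no borderline `0 ≠ K ≠ M_κ` (`ℚ̄`-data),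
`w ∈ 𝔟` with `exp(w)` algebraic, and assume the engine output at `w` (as in
`dichotomy_of_engine`). Then `w ∈ ker(exp)`. Proof: the first run gives a borderline obstruction
`K` over `ℂ` with `r·w ∈ Lie K + ker`; by stability `Lie K = 0`, so `r·w ∈ ker`; hence `w` has
TORSION abelian part and, were `w ∉ ker`, the landed second run `torsionDichotomy` would produce a
borderline `0 ≠ 𝔨₂ ≠ Lie M_κ` — impossible. [cite: BakerWustholz2007, Thm. 6.15, §6.8 (pp. 116–119)] -/
theorem mem_ker_of_stable_alg [DecidableEq γ] [DecidableEq β] [DecidableEq δ] (hphil : philippon1986_std)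
    (L : PeriodPair) (h₂ : IsAlgebraic ℚ L.g₂) (h₃ : IsAlgebraic ℚ L.g₃) (hCM : ¬ L.HasCM)
    (κM : δ → γ → Kbar)
    {𝔟 : Submodule ℂ (β ⊕ (γ ⊕ δ) → ℂ)} (hrat : IsKRational Kbar 𝔟) (h𝔟 : 𝔟 ≠ ⊤)
    (hss : Semistable κM 𝔟)
    (hst : ∀ D : SubgroupData β γ δ κM, D.tangent ≠ ⊤ → D.tangent ≠ ⊥ →
      Module.finrank ℂ 𝔟 * (Fintype.card (β ⊕ (γ ⊕ δ)) - Module.finrank ℂ D.tangent) ≠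
        (Module.finrank ℂ 𝔟 - Module.finrank ℂ ↥(𝔟 ⊓ D.tangent)) * Fintype.card (β ⊕ (γ ⊕ δ)))
    {w : β ⊕ (γ ⊕ δ) → ℂ} (hw𝔟 : w ∈ 𝔟) (hw : w ∈ Alg L κM)
    (heng : 0 < Module.finrank ℂ 𝔟 → ∀ c : ℝ, 0 < c →
      ∃ (D S T : ℕ) (P : MvPolynomial (Option β × ThetaIdx γ δ) ℂ), 1 ≤ D ∧ 1 ≤ S ∧
        P.IsHomogeneous D ∧ (∃ w', thetaEval L κM P w' ≠ 0) ∧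
        (∀ s : ℕ, s ≤ Fintype.card (β ⊕ (γ ⊕ δ)) * S →
          VanishesAlong 𝔟 (thetaEval L κM P) ((s : ℂ) • w) (Fintype.card (β ⊕ (γ ⊕ δ)) * T + 1)) ∧
        ∀ e m : ℕ, m < Fintype.card (β ⊕ (γ ⊕ δ)) →
          Module.finrank ℂ 𝔟 * (Fintype.card (β ⊕ (γ ⊕ δ)) - m) ≤ e * Fintype.card (β ⊕ (γ ⊕ δ)) →
          c * (D : ℝ) ^ Fintype.card (β ⊕ (γ ⊕ δ)) < (Nat.choose (T + e) e : ℝ) * ((S : ℝ) + 1) * (D : ℝ) ^ m ∧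
          (Module.finrank ℂ 𝔟 * (Fintype.card (β ⊕ (γ ⊕ δ)) - m) < e * Fintype.card (β ⊕ (γ ⊕ δ)) →
            c * (D : ℝ) ^ Fintype.card (β ⊕ (γ ⊕ δ)) < (Nat.choose (T + e) e : ℝ) * (D : ℝ) ^ m)) :
    w ∈ ker L κM := by
  by_contra hwker
  -- the first run of Baker's method, from the engine output
  obtain ⟨K, hKtop, hbord, r, hr, hrmem⟩ :=
    dichotomy_of_engine hphil L h₂ h₃ hCM κM hrat h𝔟 hss hw𝔟 heng
  -- by stability, `Lie K = 0`
  have hKbot : K.tangent = ⊥ := by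
    by_contra hKbot
    obtain ⟨D, hDtop, hDbot, hDbord⟩ := hss.exists_borderline_rational κM hrat K hKtop hKbot hbord
    exact hst D hDtop hDbot hDbord
  -- so `r·w` is a period, and `w` has torsion abelian part: the landed second run
  have hrw : (r : ℂ) • w ∈ ker L κM := (mem_preimageSubgroup_of_tangent_eq_bot L κM hKbot).mp hrmem
  have hwt : w ∈ AlgTors L κM := mem_AlgTors_of_smul_mem_ker L κM hw hr hrw
  obtain ⟨K₂, hK₂top, hK₂bot, hK₂bord⟩ :=
    torsionDichotomy hphil L h₂ h₃ hCM κM hrat h𝔟 hss hw𝔟 hwt hr hrw hwker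
  obtain ⟨D, hDtop, hDbot, hDbord⟩ := hss.exists_borderline_rational κM hrat K₂ hK₂top hK₂bot hK₂bord
  exact hst D hDtop hDbot hDbord

/-! ### The induction over borderline quotients and subgroups, at all algebraic points -/

/-- **The Semistability Theorem for `M_κ` at ALL algebraic points, at dimension `n`, by strong
induction on `n`** (modulo Philippon's zero estimate and the engine output at all algebraic points
of all standard models for `Λ`): for `Λ` with algebraic invariants and no CM, every standard model
`M_κ` of dimension `n`, every semistable proper `ℚ̄`-rational `𝔟 ⊆ Lie M_κ` and every `w ∈ 𝔟`
with `exp(w)` algebraic, `w ∈ ker(exp)`. The proof is that of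
`SemistabilityInduction.mem_ker_of_semistable_card` with `Alg` in place of `AlgTors`
(`inv_natCast_smul_mem_Alg`, `QuotData.Φ_mem_Alg`, `SubData.mem_Alg_of_ι`, `mem_ker_of_stable_alg`).
[cite: BakerWustholz2007, Thm. 6.15, §6.8 (p. 115: induction over G^* and B ∩ ker π; pp. 116–119)] -/
theorem mem_ker_of_semistable_card_alg (hphil : philippon1986_std) (L : PeriodPair)
    (h₂ : IsAlgebraic ℚ L.g₂) (h₃ : IsAlgebraic ℚ L.g₃) (hCM : ¬ L.HasCM)
    (heng : ∀ (β γ δ : Type) [Fintype β] [Fintype γ] [Fintype δ] [DecidableEq γ] (κM : δ → γ → Kbar)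
      (𝔟 : Submodule ℂ (β ⊕ (γ ⊕ δ) → ℂ)), IsKRational Kbar 𝔟 → 𝔟 ≠ ⊤ → Semistable κM 𝔟 →
      ∀ w ∈ 𝔟, w ∈ Alg L κM → 0 < Module.finrank ℂ 𝔟 → ∀ c : ℝ, 0 < c →
      ∃ (D S T : ℕ) (P : MvPolynomial (Option β × ThetaIdx γ δ) ℂ), 1 ≤ D ∧ 1 ≤ S ∧
        P.IsHomogeneous D ∧ (∃ w', thetaEval L κM P w' ≠ 0) ∧
        (∀ s : ℕ, s ≤ Fintype.card (β ⊕ (γ ⊕ δ)) * S →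
          VanishesAlong 𝔟 (thetaEval L κM P) ((s : ℂ) • w) (Fintype.card (β ⊕ (γ ⊕ δ)) * T + 1)) ∧
        ∀ e m : ℕ, m < Fintype.card (β ⊕ (γ ⊕ δ)) →
          Module.finrank ℂ 𝔟 * (Fintype.card (β ⊕ (γ ⊕ δ)) - m) ≤ e * Fintype.card (β ⊕ (γ ⊕ δ)) →
          c * (D : ℝ) ^ Fintype.card (β ⊕ (γ ⊕ δ)) < (Nat.choose (T + e) e : ℝ) * ((S : ℝ) + 1) * (D : ℝ) ^ m ∧
          (Module.finrank ℂ 𝔟 * (Fintype.card (β ⊕ (γ ⊕ δ)) - m) < e * Fintype.card (β ⊕ (γ ⊕ δ)) →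
            c * (D : ℝ) ^ Fintype.card (β ⊕ (γ ⊕ δ)) < (Nat.choose (T + e) e : ℝ) * (D : ℝ) ^ m))
    (n : ℕ) :
    ∀ (β γ δ : Type) [Fintype β] [Fintype γ] [Fintype δ] (κM : δ → γ → Kbar)
      (𝔟 : Submodule ℂ (β ⊕ (γ ⊕ δ) → ℂ)), Fintype.card (β ⊕ (γ ⊕ δ)) = n →
      IsKRational Kbar 𝔟 → 𝔟 ≠ ⊤ → Semistable κM 𝔟 →
      ∀ w ∈ 𝔟, w ∈ Alg L κM → w ∈ ker L κM := by
  induction n using Nat.strong_induction_on with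
  | _ n ih =>
  intro β γ δ _ _ _ κM 𝔟 hn hrat h𝔟 hss w hw𝔟 hw
  classical
  by_cases hbord : ∃ D : SubgroupData β γ δ κM, D.tangent ≠ ⊤ ∧ D.tangent ≠ ⊥ ∧
      finrank ℂ 𝔟 * (Fintype.card (β ⊕ (γ ⊕ δ)) - finrank ℂ D.tangent) =
        (finrank ℂ 𝔟 - finrank ℂ ↥(𝔟 ⊓ D.tangent)) * Fintype.card (β ⊕ (γ ⊕ δ))
  · -- a borderline `0 ≠ K₀ ≠ M_κ`: induct over `M_κ/K₀` and `K₀`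
    obtain ⟨D₀, hD₀top, hD₀bot, hD₀bord⟩ := hbord
    have hk₀lt : finrank ℂ ↥D₀.tangent < n := by
      have := Submodule.finrank_lt hD₀top; simpa [hn] using this
    -- Step 1: `w ∈ Lie K₀`, through the quotient `M_κ/K₀` at all division points `w/m`
    obtain ⟨Q⟩ := nonempty_quotData D₀
    obtain ⟨hrat', htop', hss'⟩ := Q.transport hrat h𝔟 hss hD₀top hD₀bord
    have hcard' : Fintype.card Q.σ' < n := by
      have hk₀pos : 0 < finrank ℂ ↥D₀.tangent := by
        rw [Nat.pos_iff_ne_zero, Ne, Submodule.finrank_eq_zero]; exact hD₀bot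
      have := Q.card_eq; rw [hn] at this; omega
    have hwD₀ : w ∈ D₀.tangent := by
      refine D₀.mem_tangent_of_forall_exists (L := L) w fun m hm => ?_
      have hwm : (m : ℂ)⁻¹ • w ∈ Alg L κM := inv_natCast_smul_mem_Alg L κM h₂ h₃ hw hm
      have hwm𝔟 : (m : ℂ)⁻¹ • w ∈ 𝔟 := Submodule.smul_mem _ _ hw𝔟
      have hΦ : Q.Φ ((m : ℂ)⁻¹ • w) ∈ ker L Q.κM' :=
        ih _ hcard' (Fin Q.nA) (Fin Q.nC) (Fin Q.nΞ) Q.κM' (𝔟.map Q.Φ) rfl hrat' htop' hss' _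
          (Submodule.mem_map_of_mem hwm𝔟) (Q.Φ_mem_Alg h₂ h₃ hwm)
      obtain ⟨k, hk, hh⟩ := Q.exists_ker_of_Φ_mem_ker hΦ
      refine ⟨k, hk, (m : ℂ)⁻¹ • w - k, hh, ?_⟩
      have hm0 : (m : ℂ) ≠ 0 := by exact_mod_cast hm.ne'
      rw [add_sub_cancel, smul_smul, mul_inv_cancel₀ hm0, one_smul]
    -- Step 2: transport to the subgroup `K₀ = M_κ''`
    obtain ⟨S⟩ := nonempty_subData D₀
    obtain ⟨hratS, htopS, hssS⟩ := S.transport hrat h𝔟 hss hD₀top hD₀bot hD₀bord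
    have hcardS : Fintype.card S.σ' < n := by rw [S.card_eq]; exact hk₀lt
    obtain ⟨w', hw'⟩ := S.exists_eq_ι hwD₀
    have hw'𝔟 : w' ∈ 𝔟.comap S.ι := by show S.ι w' ∈ 𝔟; rw [hw']; exact hw𝔟
    have hw'alg : w' ∈ Alg L S.κS := S.mem_Alg_of_ι h₂ h₃ (by rw [hw']; exact hw)
    have hker' := ih _ hcardS (Fin S.nA) (Fin S.nC) (Fin S.nΞ) S.κS (𝔟.comap S.ι) rfl hratS htopS hssS
      w' hw'𝔟 hw'alg
    rw [← hw']
    exact S.ι_mem_ker hker'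
  · -- `𝔟` is stable: the two runs of Baker's method
    push Not at hbord
    exact mem_ker_of_stable_alg hphil L h₂ h₃ hCM κM hrat h𝔟 hss (fun D h1 h2 => hbord D h1 h2) hw𝔟 hw
      (heng β γ δ κM 𝔟 hrat h𝔟 hss w hw𝔟 hw)

/-! ### The engine output at points with torsion abelian part (landed) -/

/-- **The landed torsion engine delivers the engine output**: at a point `w ∈ 𝔟 ∩ AlgTors`
(torsion abelian part) of a `ℚ̄`-rational `𝔟` with `0 < dim 𝔟 < n`, for every `c > 0` the Baker
engine (`BakerData.engine₂` with the parameters of `BakerData.admissibleParams_of_lt`) produces a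
form as in the hypothesis of `dichotomy_of_engine`. Hence only the points with NON-torsion abelian
part remain for `semistabilityTheorem_std`. [cite: BakerWustholz2007, §6.8 (pp. 117–119)] -/
theorem engine_of_algTors [DecidableEq γ] [DecidableEq β] [DecidableEq δ] (L : PeriodPair)
    (h₂ : IsAlgebraic ℚ L.g₂) (h₃ : IsAlgebraic ℚ L.g₃) (κM : δ → γ → Kbar)
    {𝔟 : Submodule ℂ (β ⊕ (γ ⊕ δ) → ℂ)} (hrat : IsKRational Kbar 𝔟) (h𝔟 : 𝔟 ≠ ⊤)
    {w : β ⊕ (γ ⊕ δ) → ℂ} (hw𝔟 : w ∈ 𝔟) (hw : w ∈ AlgTors L κM) (h𝔟pos : 0 < Module.finrank ℂ 𝔟)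
    {c : ℝ} (hc : 0 < c) :
    ∃ (D S T : ℕ) (P : MvPolynomial (Option β × ThetaIdx γ δ) ℂ), 1 ≤ D ∧ 1 ≤ S ∧
      P.IsHomogeneous D ∧ (∃ w', thetaEval L κM P w' ≠ 0) ∧
      (∀ s : ℕ, s ≤ Fintype.card (β ⊕ (γ ⊕ δ)) * S →
        VanishesAlong 𝔟 (thetaEval L κM P) ((s : ℂ) • w) (Fintype.card (β ⊕ (γ ⊕ δ)) * T + 1)) ∧
      ∀ e m : ℕ, m < Fintype.card (β ⊕ (γ ⊕ δ)) →
        Module.finrank ℂ 𝔟 * (Fintype.card (β ⊕ (γ ⊕ δ)) - m) ≤ e * Fintype.card (β ⊕ (γ ⊕ δ)) →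
        c * (D : ℝ) ^ Fintype.card (β ⊕ (γ ⊕ δ)) < (Nat.choose (T + e) e : ℝ) * ((S : ℝ) + 1) * (D : ℝ) ^ m ∧
        (Module.finrank ℂ 𝔟 * (Fintype.card (β ⊕ (γ ⊕ δ)) - m) < e * Fintype.card (β ⊕ (γ ⊕ δ)) →
          c * (D : ℝ) ^ Fintype.card (β ⊕ (γ ⊕ δ)) < (Nat.choose (T + e) e : ℝ) * (D : ℝ) ^ m) := by
  set n := Fintype.card (β ⊕ (γ ⊕ δ)) with hn
  have h𝔟lt : Module.finrank ℂ 𝔟 < n := by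
    have := Submodule.finrank_lt h𝔟; simpa [hn] using this
  -- the Baker datum and admissible parameters
  obtain ⟨B, hBL, hBκ, hBv, hBdd, hBspan⟩ := exists_bakerData L h₂ h₃ κM hrat hw
  have hdd : B.dd < Fintype.card (β ⊕ (γ ⊕ δ)) := by rw [hBdd]; exact h𝔟lt
  obtain ⟨D', T, S₀, S, T'', R, hT, hD', hS, hpq, hR0, hR, hnum, hineq⟩ := B.admissibleParams_of_lt hdd hc
  -- run the engine
  have hv : B.v ∈ B.bSpan := by
    show B.v ∈ Submodule.span ℂ (Set.range B.xs)
    rw [hBspan, hBv]; exact hw𝔟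
  obtain ⟨P, hP, hne, hvan⟩ := B.engine₂ hv D' T S₀ (n * S) (n * T'' + 1) R hT hpq hR0 (by exact_mod_cast hR) hnum
  have hD1 : 1 ≤ n * D' := Nat.one_le_iff_ne_zero.mpr (Nat.mul_ne_zero (by omega) (by omega))
  refine ⟨n * D', S, T'', P, hD1, hS, hP, ?_, ?_, ?_⟩
  · rwa [hBL, hBκ] at hne
  · intro s hs
    have := hvan s hs
    rwa [show B.bSpan = 𝔟 from hBspan, hBL, hBκ, hBv] at this
  · intro e m hm hidx
    have hm' : m < Fintype.card (β ⊕ (γ ⊕ δ)) := hn ▸ hm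
    have hidx' : B.dd * (Fintype.card (β ⊕ (γ ⊕ δ)) - m) ≤ e * Fintype.card (β ⊕ (γ ⊕ δ)) := by
      rw [hBdd, ← hn]; exact hidx
    have := hineq e m hm' hidx'
    rw [hBdd, ← hn] at this
    exact this

end Std

end GaGmE

open GaGmE GaGmE.Std in
/-- **Baker–Wüstholz's Semistability Theorem for the explicit group varieties `M_κ`, every proper
semistable `ℚ̄`-rational `𝔟`, at EVERY algebraic point** (`semistabilityTheorem_std`) **follows
from Philippon's zero estimate on `M_κ` and the output of the Baker engine at all algebraic
points** (a form `P` of degree `D ≥ 1`, `F_P ≢ 0`, vanishing to order `≥ nT + 1` along `𝔟` at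
`s·w`, `s ≤ nS`, with parameters beating Philippon's constant — op. cit. §6.8, pp. 117–119, the
constructive half; delivered at points with torsion abelian part by the landed engine,
`Std.engine_of_algTors`). [cite: BakerWustholz2007, Thm. 6.15 (Semistability Theorem), §6.8] [cite: Philippon1986, Thm 2.1] -/
theorem semistabilityTheorem_std_of_engine (hphil : philippon1986_std)
    (heng : ∀ (L : PeriodPair), IsAlgebraic ℚ L.g₂ → IsAlgebraic ℚ L.g₃ → ¬ L.HasCM →
      ∀ (β γ δ : Type) [Fintype β] [Fintype γ] [Fintype δ] [DecidableEq γ] (κM : δ → γ → Kbar)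
      (𝔟 : Submodule ℂ (β ⊕ (γ ⊕ δ) → ℂ)), LiePresentation.IsKRational Kbar 𝔟 → 𝔟 ≠ ⊤ →
      Semistable κM 𝔟 → ∀ w ∈ 𝔟, w ∈ Alg L κM → 0 < Module.finrank ℂ 𝔟 → ∀ c : ℝ, 0 < c →
      ∃ (D S T : ℕ) (P : MvPolynomial (Option β × ThetaIdx γ δ) ℂ), 1 ≤ D ∧ 1 ≤ S ∧
        P.IsHomogeneous D ∧ (∃ w', thetaEval L κM P w' ≠ 0) ∧
        (∀ s : ℕ, s ≤ Fintype.card (β ⊕ (γ ⊕ δ)) * S →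
          VanishesAlong 𝔟 (thetaEval L κM P) ((s : ℂ) • w) (Fintype.card (β ⊕ (γ ⊕ δ)) * T + 1)) ∧
        ∀ e m : ℕ, m < Fintype.card (β ⊕ (γ ⊕ δ)) →
          Module.finrank ℂ 𝔟 * (Fintype.card (β ⊕ (γ ⊕ δ)) - m) ≤ e * Fintype.card (β ⊕ (γ ⊕ δ)) →
          c * (D : ℝ) ^ Fintype.card (β ⊕ (γ ⊕ δ)) < (Nat.choose (T + e) e : ℝ) * ((S : ℝ) + 1) * (D : ℝ) ^ m ∧
          (Module.finrank ℂ 𝔟 * (Fintype.card (β ⊕ (γ ⊕ δ)) - m) < e * Fintype.card (β ⊕ (γ ⊕ δ)) →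
            c * (D : ℝ) ^ Fintype.card (β ⊕ (γ ⊕ δ)) < (Nat.choose (T + e) e : ℝ) * (D : ℝ) ^ m)) :
    semistabilityTheorem_std :=
  fun L h₂ h₃ hCM β γ δ _ _ _ κM 𝔟 hrat h𝔟 hss w hw𝔟 hw =>
    mem_ker_of_semistable_card_alg hphil L h₂ h₃ hCM (heng L h₂ h₃ hCM) _ β γ δ κM 𝔟 rfl hrat h𝔟 hss
      w hw𝔟 hw

end Literature.NumberTheory.Transcendental

end
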